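import Mathlib
import Literature.Analysis.FluidPDE.Tao2016AveragedNS.ShiftSetCascadeFlows
import Literature.Analysis.FluidPDE.Tao2016AveragedNS.RestartedCascadeFlows
import Summits.NavierStokesRegularity.NavierStokesRegularity.Theorems.TaoLadderRungTwoFlatCertificateGluePiecewiseGaussianOn
import HarnessLib

/-!
# Certificate glue on a shift set `𝕊`, VIII-b: DISCHARGING THE QUIET-TAIL `∀K`-STATICS for the two-level profile
  `ν(Ka) = ν₀`, `ν(K) = ν₁ (K ≥ Ka+1)` and the piecewise-Gaussian weight, from finitely many scalar checks (helper for
  item stmt-NavierStokesRegularity-22987 `FlatGapCertificatesV2`, crux K_A♭ of route TaoLadderRungTwoFlat; cell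
  harvest/h2-tao-ladder, p1 g13)

For the weight `w_k = C_w 2^{k²/2+bk}` (`k ≥ 0`), `w_k = C_w` (`k < 0`), `C_w ≥ 1`, `b ≥ 1/2`, one has
`w_{i+1} = 2^{i+1/2+b} w_i` (`i ≥ 0`), so every tail quantity of the glue theorems is eventually GEOMETRICALLY MONOTONE:
* `quiet_thin` — `(1+ε₀)^{5K/2} r w_{K-1} ≤ ϑ w_{K-2}²` for all `K ≥ Ka+1` from the single check at `K = Ka+1`, if `Ka ≥ 4`;
* `quiet_slow` — the slowness condition for all `K ≥ Ka+1` from the checks at `K = Ka+1` (with `ν₀`) and `K = Ka+2`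
  (with `ν₁`), if `Ka ≥ 2`;
* `quiet_closing` — the tail-zone closing condition for all `K ≥ Ka+1` from the checks at `K = Ka+1`, `Ka+2`;
* `quiet_shift`, `quiet_signs` — the quiet-shift inequality from `ν₁(1+ε₀)^{θ₀} ≤ ρ`; signs and the bound `max ν₀ ν₁`.

HONEST FRAMING: elementary real inequalities about a weight family and a two-level sequence; nothing is asserted about
any table or flow and nothing here is a statement about the Navier–Stokes equations.
-/

noncomputable section

-- the sub-problem namespace repeats the summit name by design (D-0017)
set_option linter.dupNamespace false

namespace Summit.NavierStokesRegularity.NavierStokesRegularity.Theorems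

open Set Literature.Analysis.FluidPDE Literature.Analysis.FluidPDE.TaoCascade

namespace CertificateGlueOn

section Quiet

variable {w ν : ℤ → ℝ} {Cw b ε₀ ν₀ ν₁ : ℝ} {Ka : ℤ}

/-- **The Gaussian step**: `w_{i+1} = 2^{i + 1/2 + b} · w_i` for `i ≥ 0`. [folklore] -/
theorem pgw_succ (hwp : ∀ k : ℤ, 0 ≤ k → w k = Cw * (2 : ℝ) ^ ((k : ℝ) ^ 2 / 2 + b * k)) (i : ℤ)
    (hi : 0 ≤ i) : w (i + 1) = (2 : ℝ) ^ ((i : ℝ) + 1 / 2 + b) * w i := by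
  rw [hwp i hi, hwp (i + 1) (by omega)]
  push_cast
  have : ((i : ℝ) + 1) ^ 2 / 2 + b * ((i : ℝ) + 1) = ((i : ℝ) + 1 / 2 + b) + ((i : ℝ) ^ 2 / 2 + b * i) := by
    ring
  rw [this, Real.rpow_add two_pos]
  ring

/-- A ratio step: `2^s · w_i ≤ w_{i+1}` whenever `i ≥ 0` and `s ≤ i + 1/2 + b`. [folklore] -/
theorem pgw_ratio_le (hCw : 1 ≤ Cw) (hb : 1 / 2 ≤ b)
    (hwp : ∀ k : ℤ, 0 ≤ k → w k = Cw * (2 : ℝ) ^ ((k : ℝ) ^ 2 / 2 + b * k))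
    (hwn : ∀ k : ℤ, k < 0 → w k = Cw) {s : ℝ} (i : ℤ) (hi : 0 ≤ i) (hs : s ≤ (i : ℝ) + 1 / 2 + b) :
    (2 : ℝ) ^ s * w i ≤ w (i + 1) := by
  rw [pgw_succ hwp i hi]
  exact mul_le_mul_of_nonneg_right (Real.rpow_le_rpow_of_exponent_le one_le_two hs)
    (le_trans zero_le_one (pgw_one_le hCw hb hwp hwn i))

/-- **Signs and maximum of the two-level profile**: `0 ≤ ν K ≤ max ν₀ ν₁` for `K ≥ Ka`. [folklore] -/
theorem quiet_signs (hνKa : ν Ka = ν₀) (hνhi : ∀ K : ℤ, Ka + 1 ≤ K → ν K = ν₁) (hν₀ : 0 ≤ ν₀) (hν₁ : 0 ≤ ν₁) :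
    (∀ K : ℤ, Ka ≤ K → 0 ≤ ν K) ∧ (∀ K : ℤ, Ka ≤ K → ν K ≤ max ν₀ ν₁) := by
  constructor
  · intro K hK
    rcases eq_or_lt_of_le hK with h | h
    · rw [← h, hνKa]; exact hν₀
    · rw [hνhi K (by omega)]; exact hν₁
  · intro K hK
    rcases eq_or_lt_of_le hK with h | h
    · rw [← h, hνKa]; exact le_max_left _ _
    · rw [hνhi K (by omega)]; exact le_max_right _ _

/-- **Quiet-shift** from one check: `ν₁ (1+ε₀)^{θ₀} ≤ ρ` gives `ν(k+1)(1+ε₀)^{θ₀} ≤ ρ` for all `k > Ka`. [folklore] -/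
theorem quiet_shift {θ₀ ρ : ℝ} (hνhi : ∀ K : ℤ, Ka + 1 ≤ K → ν K = ν₁) (hcheck : ν₁ * (1 + ε₀) ^ θ₀ ≤ ρ) :
    ∀ k : ℤ, Ka < k → ν (k + 1) * (1 + ε₀) ^ θ₀ ≤ ρ := by
  intro k hk
  rw [hνhi (k + 1) (by omega)]
  exact hcheck

/-- **Tail-zone CLOSING from two checks.** With `A_K := √2·√(4/3·m·(25/32 + 0·(1+ε₀)^{2K}))` (a constant) and
`B := C_bot · c · (ϑ/(1+ε₀)^{5/2})`: the checks `2(A/(2(1+ε₀)^{Ka}) + B ν₀²) ≤ ν₁` and `2(A/(2(1+ε₀)^{Ka+1}) + B ν₁²) ≤ ν₁`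
give the closing condition for every `K ≥ Ka+1` (`ε₀ > 0`: the first term decreases with `K`). [folklore] -/
theorem quiet_closing {m : ℕ} {Cbot c ϑ : ℝ} (hε : 0 < ε₀) (hνKa : ν Ka = ν₀)
    (hνhi : ∀ K : ℤ, Ka + 1 ≤ K → ν K = ν₁)
    (h1 : 2 * (Real.sqrt 2 * Real.sqrt (4 / 3 * m * (25 / 32)) / (2 * (1 + ε₀) ^ ((Ka : ℤ) : ℝ)) +
      Cbot * c * (ϑ / (1 + ε₀) ^ ((5 : ℝ) / 2)) * ν₀ ^ 2) ≤ ν₁)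
    (h2 : 2 * (Real.sqrt 2 * Real.sqrt (4 / 3 * m * (25 / 32)) / (2 * (1 + ε₀) ^ ((Ka + 1 : ℤ) : ℝ)) +
      Cbot * c * (ϑ / (1 + ε₀) ^ ((5 : ℝ) / 2)) * ν₁ ^ 2) ≤ ν₁) :
    ∀ K : ℤ, Ka + 1 ≤ K →
      2 * (Real.sqrt 2 * Real.sqrt (4 / 3 * m * (25 / 32 + 0 * (1 + ε₀) ^ ((2 : ℝ) * K))) /
          (2 * (1 + ε₀) ^ ((K - 1 : ℤ) : ℝ)) +
        Cbot * c * (ϑ / (1 + ε₀) ^ ((5 : ℝ) / 2)) * ν (K - 1) ^ 2) ≤ ν K := by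
  intro K hK
  have hq1 : 1 ≤ 1 + ε₀ := by linarith
  simp only [zero_mul, add_zero]
  set A : ℝ := Real.sqrt 2 * Real.sqrt (4 / 3 * m * (25 / 32)) with hA
  have hA0 : 0 ≤ A := by positivity
  rw [hνhi K hK]
  rcases eq_or_lt_of_le hK with h | h
  · -- K = Ka + 1
    rw [← h, show Ka + 1 - 1 = Ka by ring, hνKa]
    exact h1
  · -- K ≥ Ka + 2: ν(K-1) = ν₁ and the first term is smaller than at Ka+1
    rw [hνhi (K - 1) (by omega)]
    refine le_trans ?_ h2
    have hpow : (1 + ε₀) ^ ((Ka + 1 : ℤ) : ℝ) ≤ (1 + ε₀) ^ ((K - 1 : ℤ) : ℝ) :=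
      Real.rpow_le_rpow_of_exponent_le hq1 (by exact_mod_cast (show Ka + 1 ≤ K - 1 by omega))
    have hpos : 0 < 2 * (1 + ε₀) ^ ((Ka + 1 : ℤ) : ℝ) := by
      have := Real.rpow_pos_of_pos (by linarith : (0 : ℝ) < 1 + ε₀) (((Ka + 1 : ℤ) : ℝ)); positivity
    have hdiv : A / (2 * (1 + ε₀) ^ ((K - 1 : ℤ) : ℝ)) ≤ A / (2 * (1 + ε₀) ^ ((Ka + 1 : ℤ) : ℝ)) :=
      div_le_div_of_nonneg_left hA0 hpos (by linarith)
    linarith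

/-- **Tail-zone SLOWNESS from two checks** (`Ka ≥ 2`, piecewise-Gaussian weight, `0 < ε₀ ≤ 1`): the checks at
`K = Ka+1` (with `ν₀`, `w_{Ka-1}`) and `K = Ka+2` (with `ν₁`, `w_{Ka}`) give the slowness condition for every
`K ≥ Ka+1` — for `K ≥ Ka+2` the quantity `(1+ε₀)^{5(K-1)/2}/w_{K-2}` is nonincreasing. [folklore] -/
theorem quiet_slow {Cbot c r : ℝ} (hε : 0 < ε₀) (hε1 : ε₀ ≤ 1) (hCw : 1 ≤ Cw) (hb : 1 / 2 ≤ b)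
    (hwp : ∀ k : ℤ, 0 ≤ k → w k = Cw * (2 : ℝ) ^ ((k : ℝ) ^ 2 / 2 + b * k))
    (hwn : ∀ k : ℤ, k < 0 → w k = Cw) (hKa : 2 ≤ Ka) (hνKa : ν Ka = ν₀)
    (hνhi : ∀ K : ℤ, Ka + 1 ≤ K → ν K = ν₁) (hν₁ : 0 ≤ ν₁) (hC : 0 ≤ Cbot * c) (hr : 0 ≤ r)
    (h1 : (1 + ε₀) ^ ((5 : ℝ) * ((Ka : ℤ) : ℝ) / 2) * Cbot * c * (ν₀ * r / w (Ka - 1)) ≤ 1 / 2)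
    (h2 : (1 + ε₀) ^ ((5 : ℝ) * ((Ka + 1 : ℤ) : ℝ) / 2) * Cbot * c * (ν₁ * r / w Ka) ≤ 1 / 2) :
    ∀ K : ℤ, Ka + 1 ≤ K →
      (1 + ε₀) ^ ((5 : ℝ) * (K - 1 : ℤ) / 2) * Cbot * c * (ν (K - 1) * r / w (K - 2)) ≤ 1 / 2 := by
  have hq : 0 < 1 + ε₀ := by linarith
  have hq1 : 1 ≤ 1 + ε₀ := by linarith
  have hwpos : ∀ k, 0 < w k := fun k => lt_of_lt_of_le one_pos (pgw_one_le hCw hb hwp hwn k)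
  -- the monotone quantity F(K) := q^{5(K-1)/2} / w(K-2), nonincreasing from K = Ka+2 ≥ 4
  have hstep : ∀ K : ℤ, 4 ≤ K →
      (1 + ε₀) ^ ((5 : ℝ) * ((K + 1 - 1 : ℤ) : ℝ) / 2) / w (K + 1 - 2) ≤
        (1 + ε₀) ^ ((5 : ℝ) * ((K - 1 : ℤ) : ℝ) / 2) / w (K - 2) := by
    intro K hK4
    have e1 : K + 1 - 2 = K - 2 + 1 := by ring
    rw [e1, div_le_div_iff₀ (hwpos _) (hwpos _)]
    -- q^{5K/2} w(K-2) ≤ q^{5(K-1)/2} w(K-2+1): i.e. q^{5/2} w(K-2) ≤ w(K-1)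
    have hsplit : (1 + ε₀) ^ ((5 : ℝ) * ((K + 1 - 1 : ℤ) : ℝ) / 2) =
        (1 + ε₀) ^ ((5 : ℝ) * ((K - 1 : ℤ) : ℝ) / 2) * (1 + ε₀) ^ ((5 : ℝ) / 2) := by
      rw [← Real.rpow_add hq]; push_cast; ring_nf
    rw [hsplit]
    have hq52 : (1 + ε₀) ^ ((5 : ℝ) / 2) ≤ (2 : ℝ) ^ ((5 : ℝ) / 2) :=
      Real.rpow_le_rpow (by linarith) (by linarith) (by norm_num)
    have hrat := pgw_ratio_le hCw hb hwp hwn (s := (5 : ℝ) / 2) (K - 2) (by omega)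
      (by have : (4 : ℝ) ≤ K := (by exact_mod_cast hK4); push_cast; linarith)
    have hL : 0 ≤ (1 + ε₀) ^ ((5 : ℝ) * ((K - 1 : ℤ) : ℝ) / 2) := (Real.rpow_pos_of_pos hq _).le
    have hwK2 := (hwpos (K - 2)).le
    calc (1 + ε₀) ^ ((5 : ℝ) * ((K - 1 : ℤ) : ℝ) / 2) * (1 + ε₀) ^ ((5 : ℝ) / 2) * w (K - 2)
        = (1 + ε₀) ^ ((5 : ℝ) * ((K - 1 : ℤ) : ℝ) / 2) * ((1 + ε₀) ^ ((5 : ℝ) / 2) * w (K - 2)) := by ring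
      _ ≤ (1 + ε₀) ^ ((5 : ℝ) * ((K - 1 : ℤ) : ℝ) / 2) * ((2 : ℝ) ^ ((5 : ℝ) / 2) * w (K - 2)) :=
          mul_le_mul_of_nonneg_left (mul_le_mul_of_nonneg_right hq52 hwK2) hL
      _ ≤ (1 + ε₀) ^ ((5 : ℝ) * ((K - 1 : ℤ) : ℝ) / 2) * w (K - 2 + 1) :=
          mul_le_mul_of_nonneg_left hrat hL
  have hmono : ∀ n : ℕ, (1 + ε₀) ^ ((5 : ℝ) * ((Ka + 2 + n - 1 : ℤ) : ℝ) / 2) / w (Ka + 2 + n - 2) ≤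
      (1 + ε₀) ^ ((5 : ℝ) * ((Ka + 2 - 1 : ℤ) : ℝ) / 2) / w (Ka + 2 - 2) := by
    intro n
    induction n with
    | zero => simp
    | succ n ih =>
        have h := hstep (Ka + 2 + n) (by omega)
        have e1 : Ka + 2 + (n + 1 : ℕ) - 1 = Ka + 2 + n + 1 - 1 := by push_cast; ring
        have e2 : Ka + 2 + (n + 1 : ℕ) - 2 = Ka + 2 + n + 1 - 2 := by push_cast; ring
        rw [e1, e2]
        exact h.trans ih
  intro K hK
  rcases eq_or_lt_of_le hK with h | h
  · -- K = Ka+1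
    rw [← h, show Ka + 1 - 1 = Ka by ring, show Ka + 1 - 2 = Ka - 1 by ring, hνKa]
    exact h1
  · -- K ≥ Ka+2
    obtain ⟨n, hn⟩ : ∃ n : ℕ, K = Ka + 2 + n := ⟨(K - Ka - 2).toNat, by omega⟩
    rw [hνhi (K - 1) (by omega)]
    have hm := hmono n
    rw [← hn, show Ka + 2 - 1 = Ka + 1 by ring, show Ka + 2 - 2 = Ka by ring] at hm
    -- value(K) = F(K) · Cbot c ν₁ r ≤ F(Ka+2) · Cbot c ν₁ r ≤ 1/2
    have hX : 0 ≤ Cbot * c * (ν₁ * r) := by positivity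
    calc (1 + ε₀) ^ ((5 : ℝ) * ((K - 1 : ℤ) : ℝ) / 2) * Cbot * c * (ν₁ * r / w (K - 2))
        = ((1 + ε₀) ^ ((5 : ℝ) * ((K - 1 : ℤ) : ℝ) / 2) / w (K - 2)) * (Cbot * c * (ν₁ * r)) := by
          have := (hwpos (K - 2)).ne'; field_simp
      _ ≤ ((1 + ε₀) ^ ((5 : ℝ) * ((Ka + 1 : ℤ) : ℝ) / 2) / w Ka) * (Cbot * c * (ν₁ * r)) :=
          mul_le_mul_of_nonneg_right hm hX
      _ = (1 + ε₀) ^ ((5 : ℝ) * ((Ka + 1 : ℤ) : ℝ) / 2) * Cbot * c * (ν₁ * r / w Ka) := by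
          have := (hwpos Ka).ne'; field_simp
      _ ≤ 1 / 2 := h2

/-- **THIN TAIL from one check** (`Ka ≥ 4`, piecewise-Gaussian weight, `0 < ε₀ ≤ 1`): the check
`(1+ε₀)^{5(Ka+1)/2} r w_{Ka} ≤ ϑ w_{Ka-1}²` gives `(1+ε₀)^{5K/2} r w_{K-1} ≤ ϑ w_{K-2}²` for every `K ≥ Ka+1` — the
quantity `(1+ε₀)^{5K/2} w_{K-1}/w_{K-2}²` is nonincreasing from `K = 5`. [folklore] -/
theorem quiet_thin {r ϑ : ℝ} (hε : 0 < ε₀) (hε1 : ε₀ ≤ 1) (hCw : 1 ≤ Cw) (hb : 1 / 2 ≤ b)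
    (hwp : ∀ k : ℤ, 0 ≤ k → w k = Cw * (2 : ℝ) ^ ((k : ℝ) ^ 2 / 2 + b * k))
    (hwn : ∀ k : ℤ, k < 0 → w k = Cw) (hKa : 4 ≤ Ka) (hr : 0 ≤ r)
    (hcheck : (1 + ε₀) ^ ((5 : ℝ) * ((Ka + 1 : ℤ) : ℝ) / 2) * r * w (Ka + 1 - 1) ≤ ϑ * w (Ka + 1 - 2) ^ 2) :
    ∀ K : ℤ, Ka + 1 ≤ K → (1 + ε₀) ^ ((5 : ℝ) * K / 2) * r * w (K - 1) ≤ ϑ * w (K - 2) ^ 2 := by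
  have hq : 0 < 1 + ε₀ := by linarith
  have hwpos : ∀ k, 0 < w k := fun k => lt_of_lt_of_le one_pos (pgw_one_le hCw hb hwp hwn k)
  -- G(K) := q^{5K/2} w(K-1) / w(K-2)^2 is nonincreasing for K ≥ 5
  have hstep : ∀ K : ℤ, 5 ≤ K →
      (1 + ε₀) ^ ((5 : ℝ) * ((K + 1 : ℤ) : ℝ) / 2) * w (K + 1 - 1) / w (K + 1 - 2) ^ 2 ≤
        (1 + ε₀) ^ ((5 : ℝ) * ((K : ℤ) : ℝ) / 2) * w (K - 1) / w (K - 2) ^ 2 := by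
    intro K hK5
    have e1 : K + 1 - 1 = K - 1 + 1 := by ring
    have e2 : K + 1 - 2 = K - 2 + 1 := by ring
    rw [e1, e2, div_le_div_iff₀ (pow_pos (hwpos _) 2) (pow_pos (hwpos _) 2)]
    -- q^{5(K+1)/2} w(K) w(K-2)^2 ≤ q^{5K/2} w(K-1) w(K-1)^2, using w(K) = 2^{K-1/2+b} w(K-1),
    -- w(K-1) = 2^{K-3/2+b} w(K-2), q^{5/2} ≤ 2^{5/2}
    have hsplit : (1 + ε₀) ^ ((5 : ℝ) * ((K + 1 : ℤ) : ℝ) / 2) =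
        (1 + ε₀) ^ ((5 : ℝ) * ((K : ℤ) : ℝ) / 2) * (1 + ε₀) ^ ((5 : ℝ) / 2) := by
      rw [← Real.rpow_add hq]; push_cast; ring_nf
    have hwK : w (K - 1 + 1) = (2 : ℝ) ^ ((((K - 1 : ℤ) : ℝ)) + 1 / 2 + b) * w (K - 1) :=
      pgw_succ hwp (K - 1) (by omega)
    have hwK1 : w (K - 2 + 1) = (2 : ℝ) ^ ((((K - 2 : ℤ) : ℝ)) + 1 / 2 + b) * w (K - 2) :=
      pgw_succ hwp (K - 2) (by omega)
    have hKK : K - 2 + 1 = K - 1 := by ring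
    rw [hsplit, hwK, hKK]
    rw [hKK] at hwK1
    -- now everything in terms of w(K-2): w(K-1) = 2^{K-3/2+b} w(K-2)
    have hq52 : (1 + ε₀) ^ ((5 : ℝ) / 2) ≤ (2 : ℝ) ^ ((5 : ℝ) / 2) :=
      Real.rpow_le_rpow (by linarith) (by linarith) (by norm_num)
    have hL : 0 ≤ (1 + ε₀) ^ ((5 : ℝ) * ((K : ℤ) : ℝ) / 2) := (Real.rpow_pos_of_pos hq _).le
    have hw1 := (hwpos (K - 1)).le
    have hw2 := (hwpos (K - 2)).le
    have hKr : (5 : ℝ) ≤ K := by exact_mod_cast hK5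
    -- exponent inequality: 5/2 + (K-1+1/2+b) ≤ 2 (K-2+1/2+b) + ... precisely we need
    -- 2^{5/2} · 2^{(K-1)+1/2+b} · w(K-2)^2 · w(K-1) ≤ w(K-1)^3 = (2^{(K-2)+1/2+b})^2 w(K-2)^2 · w(K-1)
    have hexp : (2 : ℝ) ^ ((5 : ℝ) / 2) * (2 : ℝ) ^ ((((K - 1 : ℤ) : ℝ)) + 1 / 2 + b) ≤
        ((2 : ℝ) ^ ((((K - 2 : ℤ) : ℝ)) + 1 / 2 + b)) ^ 2 := by
      rw [← Real.rpow_add two_pos, ← Real.rpow_natCast, ← Real.rpow_mul zero_le_two]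
      refine Real.rpow_le_rpow_of_exponent_le one_le_two ?_
      push_cast
      nlinarith
    -- assemble
    have hw1cube : w (K - 1) * w (K - 1) ^ 2 = ((2 : ℝ) ^ ((((K - 2 : ℤ) : ℝ)) + 1 / 2 + b)) ^ 2 *
        w (K - 2) ^ 2 * w (K - 1) := by
      rw [hwK1]; ring
    calc (1 + ε₀) ^ ((5 : ℝ) * ((K : ℤ) : ℝ) / 2) * (1 + ε₀) ^ ((5 : ℝ) / 2) *
          ((2 : ℝ) ^ ((((K - 1 : ℤ) : ℝ)) + 1 / 2 + b) * w (K - 1)) * w (K - 2) ^ 2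
        = (1 + ε₀) ^ ((5 : ℝ) * ((K : ℤ) : ℝ) / 2) *
            ((1 + ε₀) ^ ((5 : ℝ) / 2) * (2 : ℝ) ^ ((((K - 1 : ℤ) : ℝ)) + 1 / 2 + b)) *
            (w (K - 2) ^ 2 * w (K - 1)) := by ring
      _ ≤ (1 + ε₀) ^ ((5 : ℝ) * ((K : ℤ) : ℝ) / 2) *
            ((2 : ℝ) ^ ((5 : ℝ) / 2) * (2 : ℝ) ^ ((((K - 1 : ℤ) : ℝ)) + 1 / 2 + b)) *
            (w (K - 2) ^ 2 * w (K - 1)) := by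
          refine mul_le_mul_of_nonneg_right (mul_le_mul_of_nonneg_left
            (mul_le_mul_of_nonneg_right hq52 (Real.rpow_nonneg zero_le_two _)) hL) (by positivity)
      _ ≤ (1 + ε₀) ^ ((5 : ℝ) * ((K : ℤ) : ℝ) / 2) * ((2 : ℝ) ^ ((((K - 2 : ℤ) : ℝ)) + 1 / 2 + b)) ^ 2 *
            (w (K - 2) ^ 2 * w (K - 1)) :=
          mul_le_mul_of_nonneg_right (mul_le_mul_of_nonneg_left hexp hL) (by positivity)
      _ = (1 + ε₀) ^ ((5 : ℝ) * ((K : ℤ) : ℝ) / 2) * w (K - 1) * w (K - 1) ^ 2 := by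
          rw [show (1 + ε₀) ^ ((5 : ℝ) * ((K : ℤ) : ℝ) / 2) * w (K - 1) * w (K - 1) ^ 2 =
            (1 + ε₀) ^ ((5 : ℝ) * ((K : ℤ) : ℝ) / 2) * (w (K - 1) * w (K - 1) ^ 2) by ring, hw1cube]
          ring
  have hmono : ∀ n : ℕ, (1 + ε₀) ^ ((5 : ℝ) * ((Ka + 1 + n : ℤ) : ℝ) / 2) * w (Ka + 1 + n - 1) /
        w (Ka + 1 + n - 2) ^ 2 ≤
      (1 + ε₀) ^ ((5 : ℝ) * ((Ka + 1 : ℤ) : ℝ) / 2) * w (Ka + 1 - 1) / w (Ka + 1 - 2) ^ 2 := by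
    intro n
    induction n with
    | zero => simp
    | succ n ih =>
        have h := hstep (Ka + 1 + n) (by omega)
        have e1 : (Ka + 1 + (n + 1 : ℕ) : ℤ) = Ka + 1 + n + 1 := by push_cast; ring
        rw [e1]
        exact h.trans ih
  intro K hK
  obtain ⟨n, hn⟩ : ∃ n : ℕ, K = Ka + 1 + n := ⟨(K - Ka - 1).toNat, by omega⟩
  have hm := hmono n
  rw [← hn] at hm
  -- G(K) · r · w(K-2)^2 ≤ G(Ka+1) · r · w(K-2)^2 ≤ ϑ w(K-2)^2 · …  via the check (divide by w(Ka-1)^2)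
  have hGcheck : (1 + ε₀) ^ ((5 : ℝ) * ((Ka + 1 : ℤ) : ℝ) / 2) * w (Ka + 1 - 1) / w (Ka + 1 - 2) ^ 2 * r ≤ ϑ := by
    have hw2 : 0 < w (Ka + 1 - 2) ^ 2 := pow_pos (hwpos _) 2
    rw [div_mul_eq_mul_div, div_le_iff₀ hw2]
    calc (1 + ε₀) ^ ((5 : ℝ) * ((Ka + 1 : ℤ) : ℝ) / 2) * w (Ka + 1 - 1) * r
        = (1 + ε₀) ^ ((5 : ℝ) * ((Ka + 1 : ℤ) : ℝ) / 2) * r * w (Ka + 1 - 1) := by ring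
      _ ≤ ϑ * w (Ka + 1 - 2) ^ 2 := hcheck
  have hw2pos : 0 < w (K - 2) ^ 2 := pow_pos (hwpos _) 2
  calc (1 + ε₀) ^ ((5 : ℝ) * K / 2) * r * w (K - 1)
      = ((1 + ε₀) ^ ((5 : ℝ) * ((K : ℤ) : ℝ) / 2) * w (K - 1) / w (K - 2) ^ 2 * r) * w (K - 2) ^ 2 := by
        have h0 := (hwpos (K - 2)).ne'; field_simp
    _ ≤ ((1 + ε₀) ^ ((5 : ℝ) * ((Ka + 1 : ℤ) : ℝ) / 2) * w (Ka + 1 - 1) / w (Ka + 1 - 2) ^ 2 * r) *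
          w (K - 2) ^ 2 :=
        mul_le_mul_of_nonneg_right (mul_le_mul_of_nonneg_right hm hr) hw2pos.le
    _ ≤ ϑ * w (K - 2) ^ 2 := mul_le_mul_of_nonneg_right hGcheck hw2pos.le

end Quiet

end CertificateGlueOn

end Summit.NavierStokesRegularity.NavierStokesRegularity.Theorems

end
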